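import Literature.MathematicalPhysics.QuantumFieldTheory.Balaban1983to89.B7Eq31BCH
import Literature.MathematicalPhysics.QuantumFieldTheory.Balaban1983to89.MatrixLogLipschitz
import HarnessLib

/-!
# DAG node N07 ([B11] Sect. F data side, road R0′ of record, located row (r1) «BCH ROW») — THE SHEARED DATUM IS THE PURE
# DATUM PLUS A COARSE PURE GAUGE PLUS A QUADRATIC REMAINDER:
# `log(S(c₋)·V″(c)·S(c₊)⁻¹) = log V″(c) + (λ(c₋) − λ(c₊)) + N₂(c)`, `λ = log∘S`, `‖N₂(c)‖ ≤ 8σ² + 20σv`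

Width seat `pub-ymgap-dag-n07-w7` (g0), `--supports stmt-QuantumFields-20542 --as helper`; count-neutral; 0 `def`, 0 `sorry`.
Plan g83 WORDS-2 (road of record R0′) + lane owner dag-n07-e g19's owner line (2026-08-28T05:47Z): «(r1) BCH ROW = n07-w7 …
currency: `mlog(S·V″·S⁻¹)` vs `mlog V″ + (λ(c₋) − λ(c₊))` with remainder `O(B₀ε₀²)` via the tree's BCH ∕ `MatrixLog` letters».

THE ROW.  On road R0′ the block datum of the Landau-gauged configuration `U₁` is the axial datum `V″` SHEARED by the intrinsic
coarse gauge `S = S_j(U₁)` of [3] (85)/(87) (dag-n07-e `Node00.ShearedAveragingFlat/…PureGauge`, the (r0) naming row):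
`V‴(c) = S(c₋)·V″(c)·S(c₊)⁻¹` on a coarse bond `c = ⟨c₋, c₊⟩`.  In logarithmic coordinates ((1.31) of [6] / (154)–(156) of
[B11]: `B = (1/i)·log V`) the shear is, TO FIRST ORDER, the coarse pure gauge `λ(c₋) − λ(c₊) = −(∂_cλ)(c)`, `λ = log S`, which
print's `H` turns into a fine pure gauge EXACTLY (this seat's `…N07FlatHOfCoarseGradient`, p607559); what is left is the
Baker–Campbell–Hausdorff remainder of the three-factor product, quadratic in the letters.  THIS FILE proves the three-factor
remainder bound from the tree's TWO-factor bound [Balaban1985Averaging] (31) (`B7Eq31BCH.eq31_of_sum_le`: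
`‖log(eˣeʸ) − X − Y‖ ≤ 2‖X‖‖Y‖` for `‖X‖ + ‖Y‖ ≤ 1/5`) applied twice, and packages it in the letters the assembly reads.

WHAT IS PROVED (namespace `Summit.QuantumFields.YangMills.Theorems.N07ShearDatumBCH`; `𝔸` a complete normed ℂ-algebra —
at the record `M_N(ℂ)` with the operator norm; `mlog` = lit-balaban's `MatrixLog.mlog`, the logarithmic series (21)).
* §1 (with lit-balaban's `B7Eq38Remainder.norm_exp_mul_exp_sub_one_le` by name) ★★ `norm_mlog_exp₃_sub_le`
  (`‖X‖ + ‖B‖ + ‖Z‖ ≤ 1/10 ⇒ ‖log(eˣ e^B e^Z) − (X + B + Z)‖ ≤ 2‖X‖‖B‖ + 2(‖X‖ + ‖B‖ + 2‖X‖‖B‖)‖Z‖`) ·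
  `norm_mlog_exp₃_sub_le'` (letters `‖X‖, ‖Z‖ ≤ ℓ`, `‖B‖ ≤ β`, `2ℓ + β ≤ 1/10` ⇒ `≤ 2ℓ² + 5ℓβ`).
* §2 `units_inv_eq_exp_neg_mlog` (`S⁻¹ = e^{−log S}` for `‖S − 1‖ < 1`) · ★★ `norm_mlog_conj_shear_sub_le`
  (`‖S± − 1‖ ≤ σ ≤ 1/80`, `‖V − 1‖ ≤ v ≤ 1/40` ⇒ `‖log(S₋VS₊⁻¹) − (log V + (log S₋ − log S₊))‖ ≤ 8σ² + 20σv`).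
* §3 (bond form; abstract `src tgt : κ → ι`, coarse gauge `S : ι → 𝔸ˣ`, datum `V : κ → 𝔸`) ★★★ `shearedDatum_split`
  (for every bond: sheared datum = datum − `(λ(c₊) − λ(c₋))` + remainder, `‖remainder‖ ≤ 8σ² + 20σv`), `norm_shearedDatum_sub_le`
  (the distance of the sheared log-datum from «datum + coarse pure gauge»), `smul_shearedDatum_split` (the `(iξ)⁻¹`-scaled letters
  `B = (iξ)⁻¹·log V` of (1.31)/(154): the same split, remainder `≤ ξ⁻¹(8σ² + 20σv)`).
HONEST SCOPE.  Banach-algebra bookkeeping over the tree's BCH/`MatrixLog` letters; `S`, `V` and their smallness are HYPOTHESES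
(at the record: `S := S_j(U₁)` of INTENT-41/42 via the record instance, `V := V″` of module 40); the (46)/(164) budget
multiplication `|HB| ≤ B₀|B|` is the assembly's one-liner and is not typed here; nothing of [B11] Sect. F's analysis is asserted;
N07 is not discharged; nothing here bears on the continuum, OS or the mass gap.

References: T. Bałaban, CMP **98** (1985) 17–51 [Balaban1985Averaging] (21) p.21, (30)–(31) p.22, (85)–(88) pp.30–31;
CMP **99** (1985) 75–102 [Balaban1985RegularSpaces] (1.29)–(1.31) pp.80–81; CMP **102** (1985) 277–309 [Balaban1985Variational]
(46) p.285, (154)–(156) pp.301–302, (164) p.303.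
-/

set_option autoImplicit false

noncomputable section

namespace Summit.QuantumFields.YangMills.Theorems.N07ShearDatumBCH

open NormedSpace
open Literature.MathematicalPhysics.QuantumFieldTheory.Balaban1983to89
open MatrixLog (mlog exp_mlog norm_mlog_le_two_mul)
open B7Eq31BCH (eq31_of_sum_le exp_one_fifth_le)
open B7Eq38Remainder (norm_exp_mul_exp_sub_one_le)

variable {𝔸 : Type*} [NormedRing 𝔸] [NormedAlgebra ℂ 𝔸] [CompleteSpace 𝔸]

/-! ## §1 The three-factor BCH remainder from the two-factor bound (31) -/

/-- ★★ **THREE-FACTOR BCH REMAINDER**: for `‖X‖ + ‖B‖ + ‖Z‖ ≤ 1/10`,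
`‖log(eˣ e^B e^Z) − (X + B + Z)‖ ≤ 2‖X‖‖B‖ + 2(‖X‖ + ‖B‖ + 2‖X‖‖B‖)‖Z‖` — (31) applied to `(X, B)` (giving `W = log(eˣe^B)`,
`‖W − X − B‖ ≤ 2‖X‖‖B‖`, `e^W = eˣe^B`) and then to `(W, Z)`. [cite: Balaban1985Averaging, (30)-(31) p.22] -/
theorem norm_mlog_exp₃_sub_le {X B Z : 𝔸} (h : ‖X‖ + ‖B‖ + ‖Z‖ ≤ 1 / 10) :
    ‖mlog (exp X * exp B * exp Z) - (X + B + Z)‖ ≤ 2 * ‖X‖ * ‖B‖ + 2 * (‖X‖ + ‖B‖ + 2 * ‖X‖ * ‖B‖) * ‖Z‖ := by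
  have hX0 : 0 ≤ ‖X‖ := norm_nonneg X
  have hB0 : 0 ≤ ‖B‖ := norm_nonneg B
  have hZ0 : 0 ≤ ‖Z‖ := norm_nonneg Z
  -- `e^X e^B` is in the domain of the logarithm
  have hP : ‖exp X * exp B - 1‖ < 1 := by
    have h1 := norm_exp_mul_exp_sub_one_le X B
    have h2 : Real.exp (‖X‖ + ‖B‖) ≤ Real.exp (1 / 5) := Real.exp_le_exp.mpr (by linarith)
    linarith [exp_one_fifth_le]
  set W := mlog (exp X * exp B) with hWdef
  have hW : exp W = exp X * exp B := exp_mlog hP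
  have hWsub : ‖W - X - B‖ ≤ 2 * ‖X‖ * ‖B‖ := eq31_of_sum_le (by linarith)
  have hWnorm : ‖W‖ ≤ ‖X‖ + ‖B‖ + 2 * ‖X‖ * ‖B‖ := by
    have e : W = (W - X - B) + X + B := by abel
    calc ‖W‖ = ‖(W - X - B) + X + B‖ := by rw [← e]
      _ ≤ ‖W - X - B‖ + ‖X‖ + ‖B‖ := norm_add₃_le
      _ ≤ ‖X‖ + ‖B‖ + 2 * ‖X‖ * ‖B‖ := by linarith
  have hXB : ‖X‖ * ‖B‖ ≤ 1 / 10 * (1 / 10) := mul_le_mul (by linarith) (by linarith) hB0 (by norm_num)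
  have hWZ : ‖W‖ + ‖Z‖ ≤ 1 / 5 := by linarith
  have h2 := eq31_of_sum_le hWZ
  rw [← hW]
  have e : mlog (exp W * exp Z) - (X + B + Z) = (mlog (exp W * exp Z) - W - Z) + (W - X - B) := by abel
  rw [e]
  have hWZ' : 2 * ‖W‖ * ‖Z‖ ≤ 2 * (‖X‖ + ‖B‖ + 2 * ‖X‖ * ‖B‖) * ‖Z‖ := by
    have := mul_le_mul_of_nonneg_right hWnorm hZ0
    linarith
  calc ‖(mlog (exp W * exp Z) - W - Z) + (W - X - B)‖
      ≤ ‖mlog (exp W * exp Z) - W - Z‖ + ‖W - X - B‖ := norm_add_le _ _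
    _ ≤ 2 * ‖X‖ * ‖B‖ + 2 * (‖X‖ + ‖B‖ + 2 * ‖X‖ * ‖B‖) * ‖Z‖ := by linarith

/-- The same with letters: `‖X‖, ‖Z‖ ≤ ℓ` (the gauge ends), `‖B‖ ≤ β` (the datum), `2ℓ + β ≤ 1/10` ⇒
`‖log(eˣ e^B e^Z) − (X + B + Z)‖ ≤ 2ℓ² + 5ℓβ` — quadratic in the gauge letter, bilinear in gauge × datum.
[cite: Balaban1985Averaging, (30)-(31) p.22] -/
theorem norm_mlog_exp₃_sub_le' {X B Z : 𝔸} {ℓ β : ℝ} (hX : ‖X‖ ≤ ℓ) (hB : ‖B‖ ≤ β) (hZ : ‖Z‖ ≤ ℓ)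
    (hℓβ : 2 * ℓ + β ≤ 1 / 10) :
    ‖mlog (exp X * exp B * exp Z) - (X + B + Z)‖ ≤ 2 * ℓ ^ 2 + 5 * ℓ * β := by
  have hX0 : 0 ≤ ‖X‖ := norm_nonneg X
  have hB0 : 0 ≤ ‖B‖ := norm_nonneg B
  have hZ0 : 0 ≤ ‖Z‖ := norm_nonneg Z
  have hℓ : 0 ≤ ℓ := hX0.trans hX
  have hβ : 0 ≤ β := hB0.trans hB
  have h := norm_mlog_exp₃_sub_le (X := X) (B := B) (Z := Z) (by linarith)
  have h1 : ‖X‖ * ‖B‖ ≤ ℓ * β := mul_le_mul hX hB hB0 hℓ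
  have h3 : (‖X‖ + ‖B‖ + 2 * ‖X‖ * ‖B‖) * ‖Z‖ ≤ (ℓ + β + 2 * ℓ * β) * ℓ :=
    mul_le_mul (by linarith) hZ hZ0 (by positivity)
  have hℓ20 : ℓ ≤ 1 / 20 := by linarith
  have h4 : ℓ * β * ℓ ≤ ℓ * β * (1 / 20) := mul_le_mul_of_nonneg_left hℓ20 (by positivity)
  nlinarith

/-! ## §2 The sheared datum `S₋·V·S₊⁻¹` near the identity -/

/-- For a unit `S` with `‖S − 1‖ < 1`: `S⁻¹ = e^{−log S}` (`e^{log S} = S`, `MatrixLog.exp_mlog`).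
[cite: Balaban1985Averaging, (21)/(27) pp.21–22] -/
theorem units_inv_eq_exp_neg_mlog (S : 𝔸ˣ) (hS : ‖(S : 𝔸) - 1‖ < 1) :
    ((S⁻¹ : 𝔸ˣ) : 𝔸) = exp (-mlog (S : 𝔸)) := by
  letI : NormedAlgebra ℚ 𝔸 := NormedAlgebra.restrictScalars ℚ ℂ 𝔸
  have h1 : exp (mlog (S : 𝔸)) = (S : 𝔸) := exp_mlog hS
  have h2 : exp (-mlog (S : 𝔸)) * exp (mlog (S : 𝔸)) = 1 := by
    rw [← exp_add_of_commute (Commute.refl (mlog (S : 𝔸))).neg_left, neg_add_cancel, exp_zero]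
  calc ((S⁻¹ : 𝔸ˣ) : 𝔸) = exp (-mlog (S : 𝔸)) * exp (mlog (S : 𝔸)) * ((S⁻¹ : 𝔸ˣ) : 𝔸) := by rw [h2, one_mul]
    _ = exp (-mlog (S : 𝔸)) * ((S : 𝔸) * ((S⁻¹ : 𝔸ˣ) : 𝔸)) := by rw [h1, mul_assoc]
    _ = exp (-mlog (S : 𝔸)) := by rw [Units.mul_inv, mul_one]

/-- ★★ **THE SHEARED DATUM TO FIRST ORDER IS «DATUM + (λ₋ − λ₊)»**: for units `S₋, S₊` with `‖S± − 1‖ ≤ σ ≤ 1/80` and `V` with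
`‖V − 1‖ ≤ v ≤ 1/40`, `‖log(S₋·V·S₊⁻¹) − (log V + (log S₋ − log S₊))‖ ≤ 8σ² + 20σv` — §1 at `X = log S₋`, `B = log V`,
`Z = −log S₊` (letters `ℓ = 2σ`, `β = 2v` by `MatrixLog.norm_mlog_le_two_mul`).
[cite: Balaban1985Averaging, (30)-(31) p.22, (87)-(88) pp.30–31; Balaban1985RegularSpaces, (1.31) p.81] -/
theorem norm_mlog_conj_shear_sub_le (Sm Sp : 𝔸ˣ) (V : 𝔸) {σ v : ℝ} (hσ : σ ≤ 1 / 80) (hv : v ≤ 1 / 40)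
    (hSm : ‖(Sm : 𝔸) - 1‖ ≤ σ) (hSp : ‖(Sp : 𝔸) - 1‖ ≤ σ) (hV : ‖V - 1‖ ≤ v) :
    ‖mlog ((Sm : 𝔸) * V * ((Sp⁻¹ : 𝔸ˣ) : 𝔸)) - (mlog V + (mlog (Sm : 𝔸) - mlog (Sp : 𝔸)))‖ ≤
      8 * σ ^ 2 + 20 * σ * v := by
  have hσ0 : 0 ≤ σ := (norm_nonneg _).trans hSm
  have hv0 : 0 ≤ v := (norm_nonneg _).trans hV
  have hSm1 : ‖(Sm : 𝔸) - 1‖ < 1 := by linarith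
  have hSp1 : ‖(Sp : 𝔸) - 1‖ < 1 := by linarith
  have hV1 : ‖V - 1‖ < 1 := by linarith
  -- the three exponential representations
  have eSm : (Sm : 𝔸) = exp (mlog (Sm : 𝔸)) := (exp_mlog hSm1).symm
  have eV : V = exp (mlog V) := (exp_mlog hV1).symm
  have eSp : ((Sp⁻¹ : 𝔸ˣ) : 𝔸) = exp (-mlog (Sp : 𝔸)) := units_inv_eq_exp_neg_mlog Sp hSp1
  -- the letters
  have lSm : ‖mlog (Sm : 𝔸)‖ ≤ 2 * σ := (norm_mlog_le_two_mul (by linarith)).trans (by linarith)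
  have lSp : ‖-mlog (Sp : 𝔸)‖ ≤ 2 * σ := by
    rw [norm_neg]; exact (norm_mlog_le_two_mul (by linarith)).trans (by linarith)
  have lV : ‖mlog V‖ ≤ 2 * v := (norm_mlog_le_two_mul (by linarith)).trans (by linarith)
  have hmain := norm_mlog_exp₃_sub_le' (X := mlog (Sm : 𝔸)) (B := mlog V) (Z := -mlog (Sp : 𝔸)) lSm lV lSp
    (by linarith)
  have e : (Sm : 𝔸) * V * ((Sp⁻¹ : 𝔸ˣ) : 𝔸) = exp (mlog (Sm : 𝔸)) * exp (mlog V) * exp (-mlog (Sp : 𝔸)) := by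
    rw [← eSm, ← eV, ← eSp]
  have e' : mlog V + (mlog (Sm : 𝔸) - mlog (Sp : 𝔸)) = mlog (Sm : 𝔸) + mlog V + -mlog (Sp : 𝔸) := by abel
  rw [e, e']
  calc ‖mlog (exp (mlog (Sm : 𝔸)) * exp (mlog V) * exp (-mlog (Sp : 𝔸))) - (mlog (Sm : 𝔸) + mlog V + -mlog (Sp : 𝔸))‖
      ≤ 2 * (2 * σ) ^ 2 + 5 * (2 * σ) * (2 * v) := hmain
    _ = 8 * σ ^ 2 + 20 * σ * v := by ring

/-! ## §3 Bond form: «sheared datum = datum + coarse pure gauge + quadratic remainder» -/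

section Bonds

variable {ι κ : Type*} (src tgt : κ → ι)

/-- The distance form of the split: `‖log(S₋VS₊⁻¹)(c) − [log V(c) − (λ(c₊) − λ(c₋))]‖ ≤ 8σ² + 20σv` on every bond.
[cite: Balaban1985RegularSpaces, (1.31) p.81; Balaban1985Averaging, (31) p.22] -/
theorem norm_shearedDatum_sub_le (S : ι → 𝔸ˣ) (V : κ → 𝔸) {σ v : ℝ} (hσ : σ ≤ 1 / 80) (hv : v ≤ 1 / 40)
    (hS : ∀ y, ‖(S y : 𝔸) - 1‖ ≤ σ) (hV : ∀ c, ‖V c - 1‖ ≤ v) (c : κ) :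
    ‖mlog ((S (src c) : 𝔸) * V c * (((S (tgt c))⁻¹ : 𝔸ˣ) : 𝔸)) -
        (mlog (V c) - (mlog (S (tgt c) : 𝔸) - mlog (S (src c) : 𝔸)))‖ ≤ 8 * σ ^ 2 + 20 * σ * v := by
  have h := norm_mlog_conj_shear_sub_le (S (src c)) (S (tgt c)) (V c) hσ hv (hS _) (hS _) (hV _)
  have e : mlog (V c) - (mlog (S (tgt c) : 𝔸) - mlog (S (src c) : 𝔸)) =
      mlog (V c) + (mlog (S (src c) : 𝔸) - mlog (S (tgt c) : 𝔸)) := by abel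
  rw [e]
  exact h

/-- ★★★ **THE R0′ SPLIT OF THE SHEARED DATUM, BOND BY BOND.**  Let `S : sites → 𝔸ˣ` be a coarse gauge with `‖S(y) − 1‖ ≤ σ ≤ 1/80`
and `V : bonds → 𝔸` a datum with `‖V(c) − 1‖ ≤ v ≤ 1/40`.  Then on every bond `c = ⟨c₋, c₊⟩` the logarithm of the sheared
datum `S(c₋)·V(c)·S(c₊)⁻¹` equals `log V(c) − (λ(c₊) − λ(c₋)) + N(c)` with `λ = log∘S` (so the middle term is MINUS the coarse
gradient of `λ` — a coarse pure gauge) and `‖N(c)‖ ≤ 8σ² + 20σv`.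
[cite: Balaban1985RegularSpaces, (1.29)-(1.31) pp.80–81; Balaban1985Variational, (154)-(156) pp.301–302; Balaban1985Averaging, (31) p.22] -/
theorem shearedDatum_split (S : ι → 𝔸ˣ) (V : κ → 𝔸) {σ v : ℝ} (hσ : σ ≤ 1 / 80) (hv : v ≤ 1 / 40)
    (hS : ∀ y, ‖(S y : 𝔸) - 1‖ ≤ σ) (hV : ∀ c, ‖V c - 1‖ ≤ v) :
    ∃ N : κ → 𝔸, (∀ c, mlog ((S (src c) : 𝔸) * V c * (((S (tgt c))⁻¹ : 𝔸ˣ) : 𝔸)) =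
        mlog (V c) - (mlog (S (tgt c) : 𝔸) - mlog (S (src c) : 𝔸)) + N c) ∧
      ∀ c, ‖N c‖ ≤ 8 * σ ^ 2 + 20 * σ * v :=
  ⟨fun c => mlog ((S (src c) : 𝔸) * V c * (((S (tgt c))⁻¹ : 𝔸ˣ) : 𝔸)) -
      (mlog (V c) - (mlog (S (tgt c) : 𝔸) - mlog (S (src c) : 𝔸))),
    fun _ => (add_sub_cancel _ _).symm, fun c => norm_shearedDatum_sub_le src tgt S V hσ hv hS hV c⟩

/-- **Physical letters** `B := (iξ)⁻¹·log V`, `λ := (iξ)⁻¹·log S` ((1.31)/(154): `V = e^{iξB}`): the same split with the remainder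
scaled by `ξ⁻¹` — `‖(iξ)⁻¹log(S₋VS₊⁻¹) − [(iξ)⁻¹log V − ((iξ)⁻¹log S₊ − (iξ)⁻¹log S₋)]‖ ≤ ξ⁻¹(8σ² + 20σv)` (`ξ > 0`).
[cite: Balaban1985RegularSpaces, (1.31) p.81; Balaban1985Variational, (154)-(155) p.301] -/
theorem smul_shearedDatum_split (S : ι → 𝔸ˣ) (V : κ → 𝔸) {σ v ξ : ℝ} (hξ : 0 < ξ) (hσ : σ ≤ 1 / 80) (hv : v ≤ 1 / 40)
    (hS : ∀ y, ‖(S y : 𝔸) - 1‖ ≤ σ) (hV : ∀ c, ‖V c - 1‖ ≤ v) (c : κ) :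
    ‖(Complex.I * ξ)⁻¹ • mlog ((S (src c) : 𝔸) * V c * (((S (tgt c))⁻¹ : 𝔸ˣ) : 𝔸)) -
        ((Complex.I * ξ)⁻¹ • mlog (V c) -
          ((Complex.I * ξ)⁻¹ • mlog (S (tgt c) : 𝔸) - (Complex.I * ξ)⁻¹ • mlog (S (src c) : 𝔸)))‖ ≤
      ξ⁻¹ * (8 * σ ^ 2 + 20 * σ * v) := by
  have h := norm_shearedDatum_sub_le src tgt S V hσ hv hS hV c
  have e : (Complex.I * ξ)⁻¹ • mlog ((S (src c) : 𝔸) * V c * (((S (tgt c))⁻¹ : 𝔸ˣ) : 𝔸)) -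
        ((Complex.I * ξ)⁻¹ • mlog (V c) -
          ((Complex.I * ξ)⁻¹ • mlog (S (tgt c) : 𝔸) - (Complex.I * ξ)⁻¹ • mlog (S (src c) : 𝔸))) =
      (Complex.I * ξ)⁻¹ • (mlog ((S (src c) : 𝔸) * V c * (((S (tgt c))⁻¹ : 𝔸ˣ) : 𝔸)) -
        (mlog (V c) - (mlog (S (tgt c) : 𝔸) - mlog (S (src c) : 𝔸)))) := by
    simp only [smul_sub]
  rw [e, norm_smul, norm_inv, Complex.norm_mul, Complex.norm_I, one_mul, Complex.norm_real, Real.norm_eq_abs,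
    abs_of_pos hξ]
  exact mul_le_mul_of_nonneg_left h (inv_nonneg.mpr hξ.le)

end Bonds

end Summit.QuantumFields.YangMills.Theorems.N07ShearDatumBCH

end
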